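import Mathlib
import Summits.ValiantsHypothesis.ValiantsHypothesis.Theorems.ValuativeGCTValuativeFlipFourRowPencilTools

/-!
# Four-row pencil transfer, part 2: the realization and the reduction of `stub_fourRowPencilRank`
# (crux `ValuativeGCT.ValuativeFlip`, stmt-ValiantsHypothesis-12624, line `four-row-count`;
# wall-breaker axis "representation stability between `m` and `m + 1`")

Main results.
* `frp_exists_gl_forms` — for `5 ≤ m`, `n < m`, every four-pencil `A` of `n × n` scalar matrices is REALISED by an
  explicit `g ∈ GL_{m²}`: the kept (last-four-variable) parts of the columns of `g` are `X_{κ₀}` at the padding position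
  and the pencil forms `Σ_u A u (i,j) • X_{κ_u}` on the block (`g = (1 + N) ∘ σ`: four transpositions moving the kept
  positions onto free slots of row `0`, then a square-zero shear).
* `frp_pencil_realization` — hence (with part 1, `frp_finrank_le_of_forms`) the four-row tangent span of
  `g · X₀₀^{m-n} per_n` (the span of `stub_fourRowPencilRank`) has dimension `≥ dim span{X_u · (∂_c per_n)(M_A)}`, an
  `m`-FREE quantity: the per side of the four-row count is representation-stable in `m` — one pencil serves every
  padded position.
* `fourRowPencilRank_aboveBottom_of_pencilBound` / `…'` — so the registered stub `stub_fourRowPencilRank` on the padded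
  range `n < m ≤ (6/5)n` follows from ONE `m`-free inequality per `n`:
  `dim span{X_u · (∂_c per_n)(M_{A_n})} ≥ 2m₁² + m₁ + 2`, `m₁ = ⌊6n/5⌋` — the combinatorial heart named by the line
  card (numerically `min(C(n+3,3), 4n² - 2n + 2) ≥ 2.88 n² + O(n)` for `n ≥ 11`, strategist kit job j018409), which
  remains OPEN here.  The bottom `m = n` of the stub is not served by this construction (no free column); for the
  crux it is the landed `valuativeFlip_cruxBody_bottom`.

Sibling (landed first, wall-breaker k4): `frt_finrank_fourRowSpan_ge` / `fourRowPencilRank_of_pencilCertificate` in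
`ValuativeGCTValuativeFlipFourRowTransfer` — every `m ≥ n` including the bottom, for pencils with an invertible `4 × 4`
cell minor.  Delta of this file: no hypothesis on the pencil (padded range `n < m`, `5 ≤ m`), explicit shear-and-swap
`g`, and the ceiling `frp_pencilBound_le_card`.

Why this is the right currency for the axis: by `frp_finrank_le_of_forms` the stub's span depends on `g` only through
four-variable linear forms, so its maximum over `g` is the same number for all `m ≥ n + 1`, while the det side of the
count (`stub_fourRowSliceBound`, exponent `2m² + m`) grows with `m`; the transfer is exact on the per side and the
growth is entirely on the det side — which is why the four-row count stops at `m ≈ √2·n` (line card §Idea) and why no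
uniform `m ↦ m+1` transfer of the flip itself exists (`not_uniform_succTransfer`,
file `ValuativeGCTValuativeFlipSuccTransfer`).

Sources: Mulmuley–Sohoni 2001 §4; this crux's `Cruxes/ValuativeFlip/Lines/four-row-count.md` and
`STRATEGY-CENSUS.md` (§Transfer, restriction varieties); M. Marcus, F. May, Canad. J. Math. 14 (1962).
-/

set_option linter.dupNamespace false

namespace Summit.ValiantsHypothesis.ValiantsHypothesis.Theorems.ValuativeFlip

open MvPolynomial
open scoped BigOperators Matrix
open Literature.NumberTheory.DiophantineGeometry Literature.Computability.AlgebraicComplexity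

/-! ## The explicit realization of a pencil by an invertible substitution (`n < m`) -/

section Construction

/-- **Realising a four-pencil by an invertible substitution.**  Let `5 ≤ m`, `n < m`, `eK : Fin 4 ≃ K` an enumeration
of the four kept (= lexicographically last) positions, `A` a four-pencil of `n × n` scalar matrices and `e : Fin n ≃ B`
a labelling of the block.  Then some `g ∈ GL_{m²}` has kept column parts `(g · X₀₀)|₄ = X_{eK 0}` and
`(g · X_{(i,j)})|₄ = Σ_u A u (e⁻¹ i, e⁻¹ j) • X_{eK u}` on the block.  Construction: `g = (1 + N) ∘ σ` with `σ` the
product of the four transpositions (kept position `eK u`) ↔ (free position `(0, u+1)`, neither kept nor in the block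
nor the padding position) and `N` the shear writing the prescribed kept parts onto the non-kept columns (`N² = 0`,
so `1 + N` is invertible).  [this file] -/
theorem frp_exists_gl_forms {n m : ℕ} [NeZero m] (hm : 5 ≤ m) (hnm : n < m)
    (eK : Fin 4 ≃ {a : MatIdx m // m * m ≤ (((matIdxEquiv m).symm a : Fin (m * m)) : ℕ) + 4})
    (A : Fin 4 → Fin n × Fin n → ℂ) (e : Fin n ≃ BlockIdx n m) :
    ∃ g : GL (MatIdx m) ℂ,
      (∑ j : MatIdx m, (g : Matrix (MatIdx m) (MatIdx m) ℂ) j (toLex ((0 : Fin m), (0 : Fin m))) •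
        (fun i : MatIdx m => if m * m ≤ (((matIdxEquiv m).symm i : Fin (m * m)) : ℕ) + 4 then
          (MvPolynomial.X i : MvPolynomial (MatIdx m) ℂ) else 0) j =
        (X (eK 0).1 : MvPolynomial (MatIdx m) ℂ)) ∧
      (∀ b : BlockIdx n m × BlockIdx n m,
        ∑ j : MatIdx m, (g : Matrix (MatIdx m) (MatIdx m) ℂ) j (toLex ((b.1 : Fin m), (b.2 : Fin m))) •
          (fun i : MatIdx m => if m * m ≤ (((matIdxEquiv m).symm i : Fin (m * m)) : ℕ) + 4 then
            (MvPolynomial.X i : MvPolynomial (MatIdx m) ℂ) else 0) j =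
          rename (fun u : Fin 4 => (eK u).1) (∑ u : Fin 4, A u (e.symm b.1, e.symm b.2) • (X u : MvPolynomial (Fin 4) ℂ))) := by
  classical
  set keep : MatIdx m → MvPolynomial (MatIdx m) ℂ := fun i =>
    if m * m ≤ (((matIdxEquiv m).symm i : Fin (m * m)) : ℕ) + 4 then (MvPolynomial.X i : MvPolynomial (MatIdx m) ℂ) else 0
    with hkeep
  set τ : Fin 4 → MatIdx m := fun u => (eK u).1 with hτ
  have hτk : ∀ u, m * m ≤ (((matIdxEquiv m).symm (τ u) : Fin (m * m)) : ℕ) + 4 := fun u => (eK u).2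
  have hτinj : Function.Injective τ := Subtype.val_injective.comp eK.injective
  have hkτ : ∀ a : MatIdx m, m * m ≤ (((matIdxEquiv m).symm a : Fin (m * m)) : ℕ) + 4 → ∃ u, a = τ u :=
    fun a ha => ⟨eK.symm ⟨a, ha⟩, by simp [hτ]⟩
  -- the padding position and the free slots
  set o : MatIdx m := toLex ((0 : Fin m), (0 : Fin m)) with ho_def
  have hmm : 25 ≤ m * m := by nlinarith
  have ho : ¬ m * m ≤ (((matIdxEquiv m).symm o : Fin (m * m)) : ℕ) + 4 := by
    rw [ho_def, frp_symm_toLex_val]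
    simp only [Fin.val_zero, mul_zero, add_zero]
    omega
  set φ : Fin 4 → MatIdx m := fun u => toLex ((0 : Fin m), (⟨(u : ℕ) + 1, by omega⟩ : Fin m)) with hφ
  have hφk : ∀ u, ¬ m * m ≤ (((matIdxEquiv m).symm (φ u) : Fin (m * m)) : ℕ) + 4 := by
    intro u
    rw [hφ, frp_symm_toLex_val]
    simp only [Fin.val_zero, mul_zero, add_zero]
    have := u.2
    omega
  have hφinj : Function.Injective φ := by
    intro u v h
    have h' := toLex.injective h
    simp only [Prod.mk.injEq, Fin.mk.injEq, true_and] at h'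
    exact Fin.ext (by omega)
  have hφo : ∀ u, φ u ≠ o := by
    intro u h
    have h' := toLex.injective h
    simp only [Prod.mk.injEq, Fin.ext_iff, Fin.val_zero, true_and] at h'
    omega
  have hφB : ∀ u (b : BlockIdx n m × BlockIdx n m), φ u ≠ toLex ((b.1 : Fin m), (b.2 : Fin m)) := by
    intro u b h
    have h' := congrArg Prod.fst (toLex.injective h)
    have hb := b.1.2
    simp only at h'
    rw [← h'] at hb
    simp only [Fin.val_zero] at hb
    omega
  have hBo : ∀ b : BlockIdx n m × BlockIdx n m, (toLex ((b.1 : Fin m), (b.2 : Fin m)) : MatIdx m) ≠ o := by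
    intro b h
    have h' := congrArg Prod.fst (toLex.injective h)
    have hb := b.1.2
    simp only at h'
    rw [h'] at hb
    simp only [Fin.val_zero] at hb
    omega
  have hτφ : ∀ u v, τ u ≠ φ v := fun u v h => hφk v (h ▸ hτk u)
  have hφτ : ∀ u v, φ u ≠ τ v := fun u v h => hτφ v u h.symm
  -- the permutation
  set π : Equiv.Perm (MatIdx m) := Equiv.swap (τ 0) (φ 0) * (Equiv.swap (τ 1) (φ 1) *
    (Equiv.swap (τ 2) (φ 2) * Equiv.swap (τ 3) (φ 3))) with hπ
  have hπφ : ∀ u, π (φ u) = τ u := by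
    intro u
    fin_cases u <;>
      simp [hπ, Equiv.Perm.mul_apply, Equiv.swap_apply_def, hτinj.eq_iff, hφinj.eq_iff, hτφ, hφτ]
  have hπfix : ∀ c, (∀ u, c ≠ τ u) → (∀ u, c ≠ φ u) → π c = c := by
    intro c h1 h2
    simp [hπ, Equiv.Perm.mul_apply, Equiv.swap_apply_of_ne_of_ne, h1, h2]
  set σ : Equiv.Perm (MatIdx m) := π.symm with hσ
  have hστ : ∀ u, σ (τ u) = φ u := fun u => by
    rw [hσ, Equiv.symm_apply_eq]
    exact (hπφ u).symm
  have hσfix : ∀ c, (∀ u, c ≠ τ u) → (∀ u, c ≠ φ u) → σ c = c := fun c h1 h2 => by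
    rw [hσ, Equiv.symm_apply_eq]
    exact (hπfix c h1 h2).symm
  have hσk : ∀ c, (∀ u, c ≠ φ u) → ¬ m * m ≤ (((matIdxEquiv m).symm (σ c) : Fin (m * m)) : ℕ) + 4 := by
    intro c hc
    by_cases h : ∃ u, c = τ u
    · obtain ⟨u, rfl⟩ := h
      rw [hστ]
      exact hφk u
    · push Not at h
      rw [hσfix c h hc]
      intro hk
      obtain ⟨u, hu⟩ := hkτ c hk
      exact h u hu
  have hπσ : ∀ c, π (σ c) = c := fun c => Equiv.apply_symm_apply π c
  -- the prescribed kept parts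
  set q : MatIdx m → Fin 4 → ℂ := fun c u =>
    if c = o then (if u = 0 then 1 else 0) else
      if h : (m - n ≤ ((ofLex c).1 : ℕ) ∧ m - n ≤ ((ofLex c).2 : ℕ)) then
        A u (e.symm ⟨(ofLex c).1, h.1⟩, e.symm ⟨(ofLex c).2, h.2⟩) else 0 with hq
  have hqo : ∀ u, q o u = if u = 0 then 1 else 0 := fun u => by simp [hq]
  have hqB : ∀ (b : BlockIdx n m × BlockIdx n m) (u : Fin 4),
      q (toLex ((b.1 : Fin m), (b.2 : Fin m))) u = A u (e.symm b.1, e.symm b.2) := by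
    intro b u
    simp only [hq, if_neg (hBo b), ofLex_toLex]
    rw [dif_pos ⟨b.1.2, b.2.2⟩]
  -- the shear and the matrix
  set N : Matrix (MatIdx m) (MatIdx m) ℂ := Matrix.of fun j k =>
    if m * m ≤ (((matIdxEquiv m).symm k : Fin (m * m)) : ℕ) + 4 then 0 else
      ∑ u : Fin 4, if j = τ u then q (π k) u else 0 with hN
  have hNk : ∀ j k, m * m ≤ (((matIdxEquiv m).symm k : Fin (m * m)) : ℕ) + 4 → N j k = 0 := by
    intro j k hk
    simp only [hN, Matrix.of_apply, if_pos hk]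
  have hNr : ∀ j k, ¬ m * m ≤ (((matIdxEquiv m).symm j : Fin (m * m)) : ℕ) + 4 → N j k = 0 := by
    intro j k hj
    simp only [hN, Matrix.of_apply]
    split_ifs
    · rfl
    · refine Finset.sum_eq_zero fun u _ => ?_
      rw [if_neg]
      rintro rfl
      exact hj (hτk u)
  have hNN : N * N = 0 := by
    ext j k
    rw [Matrix.mul_apply, Matrix.zero_apply]
    refine Finset.sum_eq_zero fun l _ => ?_
    by_cases hl : m * m ≤ (((matIdxEquiv m).symm l : Fin (m * m)) : ℕ) + 4
    · rw [hNk j l hl, zero_mul]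
    · rw [hNr l k hl, mul_zero]
  have hs : IsUnit (1 + N) := IsUnit.of_mul_eq_one (1 - N) (by
    rw [add_mul, mul_sub, mul_sub, one_mul, one_mul, mul_one, hNN, sub_zero, sub_add_cancel])
  set gmat : Matrix (MatIdx m) (MatIdx m) ℂ := (1 + N).submatrix id σ with hgmat
  have hsign : IsUnit (((Equiv.Perm.sign σ : ℤˣ) : ℤ) : ℂ) := by
    rcases Int.units_eq_one_or (Equiv.Perm.sign σ) with h | h <;> simp [h]
  have hg : IsUnit gmat := by
    rw [Matrix.isUnit_iff_isUnit_det, hgmat, Matrix.det_permute', IsUnit.mul_iff]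
    exact ⟨hsign, (Matrix.isUnit_iff_isUnit_det _).mp hs⟩
  -- the kept parts of the columns of `g` at non-free positions
  have hcol : ∀ c, (∀ u, c ≠ φ u) →
      ∑ j : MatIdx m, (hg.unit : Matrix (MatIdx m) (MatIdx m) ℂ) j c • keep j =
        ∑ u : Fin 4, q c u • (X (τ u) : MvPolynomial (MatIdx m) ℂ) := by
    intro c hc
    rw [IsUnit.unit_spec]
    have hk := hσk c hc
    have h1 : ∑ j : MatIdx m, (1 : Matrix (MatIdx m) (MatIdx m) ℂ) j (σ c) • keep j = 0 := by
      simp only [Matrix.one_apply, ite_smul, one_smul, zero_smul, Finset.sum_ite_eq', Finset.mem_univ,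
        if_true]
      simp only [hkeep, if_neg hk]
    have h2 : ∀ j, N j (σ c) = ∑ u : Fin 4, if j = τ u then q c u else 0 := by
      intro j
      simp only [hN, Matrix.of_apply, if_neg hk, hπσ]
    have h3 : ∑ j : MatIdx m, N j (σ c) • keep j = ∑ u : Fin 4, q c u • (X (τ u) : MvPolynomial (MatIdx m) ℂ) := by
      simp_rw [h2, Finset.sum_smul, ite_smul, zero_smul]
      rw [Finset.sum_comm]
      refine Finset.sum_congr rfl fun u _ => ?_
      rw [Finset.sum_ite_eq', if_pos (Finset.mem_univ _)]
      simp only [hkeep, if_pos (hτk u)]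
    simp only [hgmat, Matrix.submatrix_apply, id, Matrix.add_apply, add_smul, Finset.sum_add_distrib]
    rw [h1, h3, zero_add]
  refine ⟨hg.unit, ?_, ?_⟩
  · rw [hcol o (fun u h => hφo u h.symm)]
    simp only [hqo, ite_smul, one_smul, zero_smul, Finset.sum_ite_eq', Finset.mem_univ, if_true]
    rfl
  · intro b
    rw [hcol _ (fun u h => hφB u b h.symm), map_sum]
    refine Finset.sum_congr rfl fun u _ => ?_
    rw [hqB, map_smul, rename_X]

end Construction

/-! ## The transfer theorem and the reduction of `stub_fourRowPencilRank` on the padded range -/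

section Transfer

/-- The four kept (lexicographically last) matrix positions are enumerated by `Fin 4` (`m ≥ 2`). [folklore] -/
theorem frp_nonempty_keptEquiv {m : ℕ} (hm : 2 ≤ m) :
    Nonempty (Fin 4 ≃ {a : MatIdx m // m * m ≤ (((matIdxEquiv m).symm a : Fin (m * m)) : ℕ) + 4}) := by
  have h4 : 4 ≤ m * m := by nlinarith
  refine ⟨{ toFun := fun u => ⟨matIdxEquiv m ⟨m * m - 4 + (u : ℕ), by have := u.2; omega⟩, ?_⟩
            invFun := fun a => ⟨(((matIdxEquiv m).symm a.1 : Fin (m * m)) : ℕ) - (m * m - 4), ?_⟩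
            left_inv := ?_
            right_inv := ?_ }⟩
  · simp only [OrderIso.symm_apply_apply]
    omega
  · have h1 := a.2
    have h2 := ((matIdxEquiv m).symm a.1).2
    omega
  · intro u
    ext
    simp only [OrderIso.symm_apply_apply]
    omega
  · intro a
    apply Subtype.ext
    have h1 := a.2
    simp only
    conv_rhs => rw [← (matIdxEquiv m).apply_symm_apply a.1]
    congr 1
    ext
    simp only
    omega

/-- **Four-row pencil transfer (representation stability of the per side in `m`).**  For `5 ≤ m`, `n < m` and EVERY
four-pencil `A` of `n × n` scalar matrices there is `g ∈ GL_{m²}` whose four-row tangent span of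
`g · X₀₀^{m-n} per_n` — the span of `stub_fourRowPencilRank` of line `four-row-count` — has dimension at least the
`m`-free quantity `dim span{X_u · (∂_c per_n)(M_A) : u < 4, c}`, `M_A(c) = Σ_u A u c • X_u` (the span of the products
`y_u · Per_c(M_A(y))` of the pencil's permanental minors).  One pencil therefore serves every position of the padded
range at once: the per side of the four-row count does not see `m`.  [this file: `frp_exists_gl_forms` +
`frp_finrank_le_of_forms`; line card `four-row-count` §Stubs] -/
theorem frp_pencil_realization {n m : ℕ} [NeZero m] (hm : 5 ≤ m) (hnm : n < m) (A : Fin 4 → Fin n × Fin n → ℂ) :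
    ∃ g : GL (MatIdx m) ℂ,
      Module.finrank ℂ ↥(Submodule.span ℂ (Set.range fun uc : Fin 4 × (Fin n × Fin n) =>
        (MvPolynomial.X uc.1 : MvPolynomial (Fin 4) ℂ) *
          MvPolynomial.aeval (fun c : Fin n × Fin n => ∑ u : Fin 4, A u c • (MvPolynomial.X u : MvPolynomial (Fin 4) ℂ))
            (MvPolynomial.pderiv uc.2 (perPoly (Fin n) ℂ)))) ≤
      Module.finrank ℂ ↥(Submodule.span ℂ (Set.range fun ab : {a : MatIdx m // m * m ≤ (((matIdxEquiv m).symm a : Fin (m * m)) : ℕ) + 4} × MatIdx m => (MvPolynomial.X ab.1.1 : MvPolynomial (MatIdx m) ℂ) * MvPolynomial.aeval (fun i : MatIdx m => if m * m ≤ (((matIdxEquiv m).symm i : Fin (m * m)) : ℕ) + 4 then (MvPolynomial.X i : MvPolynomial (MatIdx m) ℂ) else 0) (MvPolynomial.pderiv ab.2 (linSubst (MatIdx m) ℂ ((g : GL (MatIdx m) ℂ) : Matrix (MatIdx m) (MatIdx m) ℂ) (paddedPerFormLex ℂ n m))))) := by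
  classical
  obtain ⟨eK⟩ := frp_nonempty_keptEquiv (m := m) (by omega)
  set e : Fin n ≃ BlockIdx n m := (Fintype.equivFinOfCardEq (card_blockIdx hnm.le)).symm with he
  obtain ⟨g, h0, hB⟩ := frp_exists_gl_forms hm hnm eK A e
  exact ⟨g, frp_finrank_le_of_forms eK g A e (by rw [h0]) hB⟩

/-- **`stub_fourRowPencilRank` above the bottom, from an `m`-free pencil bound.**  If for all large `n` some
four-pencil `A_n` has `dim span{X_u · (∂_c per_n)(M_{A_n})} ≥ 2m² + m + 2` for every `n < m ≤ (6/5)·n` (a condition on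
the single number `dim span{…}`, see `fourRowPencilRank_aboveBottom_of_pencilBound'`), then the registered stub
`stub_fourRowPencilRank` of line `four-row-count` holds at every PADDED position `n < m`, `5m ≤ 6n` (its conclusion
verbatim).  The bottom `m = n` of the stub is not served here (no free column to absorb the kept block positions);
for the crux it is covered by the landed bottom theorem `valuativeFlip_cruxBody_bottom`. [this file] -/
theorem fourRowPencilRank_aboveBottom_of_pencilBound
    (h : ∃ n₀ : ℕ, ∀ n ≥ n₀, ∃ A : Fin 4 → Fin n × Fin n → ℂ, ∀ m : ℕ, n < m → 5 * m ≤ 6 * n →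
      2 * m ^ 2 + m + 2 ≤ Module.finrank ℂ ↥(Submodule.span ℂ (Set.range fun uc : Fin 4 × (Fin n × Fin n) =>
        (MvPolynomial.X uc.1 : MvPolynomial (Fin 4) ℂ) *
          MvPolynomial.aeval (fun c : Fin n × Fin n => ∑ u : Fin 4, A u c • (MvPolynomial.X u : MvPolynomial (Fin 4) ℂ))
            (MvPolynomial.pderiv uc.2 (perPoly (Fin n) ℂ))))) :
    ∃ n₀ : ℕ, ∀ n ≥ n₀, ∀ (m : ℕ) [NeZero m], n < m → 5 * m ≤ 6 * n →
      ∃ g : GL (MatIdx m) ℂ, 2 * m ^ 2 + m + 2 ≤ Module.finrank ℂ ↥(Submodule.span ℂ (Set.range fun ab : {a : MatIdx m // m * m ≤ (((matIdxEquiv m).symm a : Fin (m * m)) : ℕ) + 4} × MatIdx m => (MvPolynomial.X ab.1.1 : MvPolynomial (MatIdx m) ℂ) * MvPolynomial.aeval (fun i : MatIdx m => if m * m ≤ (((matIdxEquiv m).symm i : Fin (m * m)) : ℕ) + 4 then (MvPolynomial.X i : MvPolynomial (MatIdx m) ℂ) else 0) (MvPolynomial.pderiv ab.2 (linSubst (MatIdx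 m) ℂ ((g : GL (MatIdx m) ℂ) : Matrix (MatIdx m) (MatIdx m) ℂ) (paddedPerFormLex ℂ n m))))) := by
  obtain ⟨n₀, hn₀⟩ := h
  refine ⟨max n₀ 4, fun n hn m _ hnm h56 => ?_⟩
  obtain ⟨A, hA⟩ := hn₀ n (le_of_max_le_left hn)
  have hm : 5 ≤ m := by have := le_of_max_le_right hn; omega
  obtain ⟨g, hg⟩ := frp_pencil_realization hm hnm A
  exact ⟨g, (hA m hnm h56).trans hg⟩

/-- **The same from ONE inequality per `n`.**  Since the pencil quantity does not depend on `m`, it suffices that for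
all large `n` some four-pencil `A_n` has `dim span{X_u · (∂_c per_n)(M_{A_n})} ≥ 2 m₁² + m₁ + 2` at the top
`m₁ = ⌊6n/5⌋` of the linear head; this is the `m`-free combinatorial heart the axis reduces the stub to
(numerically `dim = min(C(n+3,3), 4n² - 2n + 2)`, strategist kit job j018409). [this file] -/
theorem fourRowPencilRank_aboveBottom_of_pencilBound'
    (h : ∃ n₀ : ℕ, ∀ n ≥ n₀, ∃ A : Fin 4 → Fin n × Fin n → ℂ,
      2 * (6 * n / 5) ^ 2 + 6 * n / 5 + 2 ≤ Module.finrank ℂ ↥(Submodule.span ℂ (Set.range fun uc : Fin 4 × (Fin n × Fin n) =>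
        (MvPolynomial.X uc.1 : MvPolynomial (Fin 4) ℂ) *
          MvPolynomial.aeval (fun c : Fin n × Fin n => ∑ u : Fin 4, A u c • (MvPolynomial.X u : MvPolynomial (Fin 4) ℂ))
            (MvPolynomial.pderiv uc.2 (perPoly (Fin n) ℂ))))) :
    ∃ n₀ : ℕ, ∀ n ≥ n₀, ∀ (m : ℕ) [NeZero m], n < m → 5 * m ≤ 6 * n →
      ∃ g : GL (MatIdx m) ℂ, 2 * m ^ 2 + m + 2 ≤ Module.finrank ℂ ↥(Submodule.span ℂ (Set.range fun ab : {a : MatIdx m // m * m ≤ (((matIdxEquiv m).symm a : Fin (m * m)) : ℕ) + 4} × MatIdx m => (MvPolynomial.X ab.1.1 : MvPolynomial (MatIdx m) ℂ) * MvPolynomial.aeval (fun i : MatIdx m => if m * m ≤ (((matIdxEquiv m).symm i : Fin (m * m)) : ℕ) + 4 then (MvPolynomial.X i : MvPolynomial (MatIdx m) ℂ) else 0) (MvPolynomial.pderiv ab.2 (linSubst (MatIdx m) ℂ ((g : GL (MatIdx m) ℂ) : Matrix (MatIdx m) (MatIdx m) ℂ) (paddedPerFormLex ℂ n m))))) :=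 by
  apply fourRowPencilRank_aboveBottom_of_pencilBound
  obtain ⟨n₀, hn₀⟩ := h
  refine ⟨n₀, fun n hn => ?_⟩
  obtain ⟨A, hA⟩ := hn₀ n hn
  refine ⟨A, fun m _ h56 => le_trans ?_ hA⟩
  have hm : m ≤ 6 * n / 5 := (Nat.le_div_iff_mul_le (by norm_num)).mpr (by omega)
  have h2 : m ^ 2 ≤ (6 * n / 5) ^ 2 := Nat.pow_le_pow_left hm 2
  omega

/-- **The ceiling of the pencil currency.**  The `m`-free pencil quantity is at most `4n²` (it is spanned by `4n²`
products), so the reduction `fourRowPencilRank_aboveBottom_of_pencilBound` can only ever serve positions with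
`2m² + m + 2 ≤ 4n²`, i.e. `m < √2·n`: the representation-stable per side against the det side's `2m² + O(m)` is
exactly the line card's `√2` limit of the four-row count, now a one-line formal fact. [this file; line card §Idea] -/
theorem frp_pencilBound_le_card {n : ℕ} (A : Fin 4 → Fin n × Fin n → ℂ) :
    Module.finrank ℂ ↥(Submodule.span ℂ (Set.range fun uc : Fin 4 × (Fin n × Fin n) =>
        (MvPolynomial.X uc.1 : MvPolynomial (Fin 4) ℂ) *
          MvPolynomial.aeval (fun c : Fin n × Fin n => ∑ u : Fin 4, A u c • (MvPolynomial.X u : MvPolynomial (Fin 4) ℂ))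
            (MvPolynomial.pderiv uc.2 (perPoly (Fin n) ℂ)))) ≤ 4 * (n * n) := by
  have h := finrank_range_le_card (R := ℂ) (fun uc : Fin 4 × (Fin n × Fin n) =>
        (MvPolynomial.X uc.1 : MvPolynomial (Fin 4) ℂ) *
          MvPolynomial.aeval (fun c : Fin n × Fin n => ∑ u : Fin 4, A u c • (MvPolynomial.X u : MvPolynomial (Fin 4) ℂ))
            (MvPolynomial.pderiv uc.2 (perPoly (Fin n) ℂ)))
  rw [Fintype.card_prod, Fintype.card_prod, Fintype.card_fin, Fintype.card_fin] at h
  exact h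

/-- Hence a pencil bound `2m² + m + 2 ≤ dim span{…}` forces `2m² + m + 2 ≤ 4n²` (no pencil serves `m ≥ √2·n`).
[this file] -/
theorem frp_two_mul_sq_le_of_pencilBound {n : ℕ} (A : Fin 4 → Fin n × Fin n → ℂ) {m' : ℕ}
    (h : 2 * m' ^ 2 + m' + 2 ≤ Module.finrank ℂ ↥(Submodule.span ℂ (Set.range fun uc : Fin 4 × (Fin n × Fin n) =>
        (MvPolynomial.X uc.1 : MvPolynomial (Fin 4) ℂ) *
          MvPolynomial.aeval (fun c : Fin n × Fin n => ∑ u : Fin 4, A u c • (MvPolynomial.X u : MvPolynomial (Fin 4) ℂ))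
            (MvPolynomial.pderiv uc.2 (perPoly (Fin n) ℂ))))) :
    2 * m' ^ 2 + m' + 2 ≤ 4 * (n * n) :=
  h.trans (frp_pencilBound_le_card A)

end Transfer

end Summit.ValiantsHypothesis.ValiantsHypothesis.Theorems.ValuativeFlip
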